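import Summits.QuantumFields.BalabanUV.T4Continuum.Support.NE7CubicVertexLetters
import Summits.QuantumFields.BalabanUV.T4Continuum.Support.NE7DcurlBaseLipschitz
import Summits.QuantumFields.BalabanUV.T4Continuum.Support.NE7SegmentPlaquetteRadius
import Summits.QuantumFields.BalabanUV.T4Continuum.Support.NE3SmoothLiftCurl
import Summits.QuantumFields.BalabanUV.T4Continuum.Support.AveragingDeficitDualResidual
import Summits.QuantumFields.BalabanUV.T4Continuum.Support.AveragingDeficitNearIdentity
import Summits.QuantumFields.BalabanUV.T4Continuum.Support.MinimalActionLevels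
import HarnessLib

/-!
# NE7ExpansionSegmentLetters — the LETTERS of the strong expansion remainder (EXP) at the trivial flat datum: period-box bookkeeping, THE BY-PARTS
# LETTER AT THE FLAT BACKGROUND, and the sizes along the segment `V_s = e^{sA}` (plaquette deviation, dressed curl, THE TAYLOR TAIL OF THE CURL)

Cell `pub-balaban`, rung (B)+1 sub-cell t4, lineage `b2b-balaban-t4-ne7-p1`, generation 71 (CRUX PROVER NE7 #1); memo
`t4/b2b-balaban-t4-ne7-p1-g70/HUNT-H14-APE-FLAT-SKELETON.md` §1 FACT 2 and §7 (the refined EXP plan).  File F48a (over F46 `NE7CubicVertexLetters`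
(`isUnitaryCfg_flat`, `dcurlAt_flat_shift`, `bondL1At_le_of_sup`), F47 `NE7DcurlBaseLipschitz` (`dcurlAt` Lipschitz in the base), row NE3's
`NE3CurlStability.norm_curlAt_vary_sub_le` ∕ `norm_vary_sub_le_of_sup`, `NE3SmoothLiftCurl.curlAt_flat_eq`, gen 66's
`NE7SegmentPlaquetteRadius.norm_hol_taylor_le` ∕ `hasDerivAt_curlAt_vary_at`, and the period-box shift invariance
`T4AveragingDeficitWallBoundary.sum_periodBox_shift`); consumed by F48b `NE7ExpansionRemainderFlat` (the (EXP) letter of F38's bundle at `F̃ = 1`).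
WHY.  The strong expansion remainder needs `ρ ≲ M⁻³` (memo H14 §1 FACT 2); the only term not a product of two small letters is the cubic vertex
`Σ_p Re tr[(d_1Y)(p)·𝒬(A)(p)]`, `𝒬(A) = dcurlAt 1 A A`, which is moved onto `Y` by the flat periodic summation by parts (§1) at the cost of the adjacent
differences of `𝒬(A)` (F46: `64α₀α₁`); §2 supplies the small letters along the segment, including the Taylor tail `d_sA − d_1A − s𝒬(A) = O(δα₀²)` (F47).
WHAT ([folklore] lattice calculus; 0 def, 0 sorry).
§1 `sum_perWin_bondL1At_le` (`Σ_{p ∈ perWin d P} bl₁(Y)(p) ≤ 2·#Plane·‖Y‖_{ℓ¹(periodBox P)}`), **`abs_sum_nReTr_curlAt_flat_mul_le`** (THE BY-PARTS LETTER: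
   for `P`-periodic `Y` and a `P`-periodic plaquette field `G` with adjacent differences `≤ γ`, `|Σ_{p ∈ perWin} Re tr[(d_1Y)(p)·G(p)]∕N| ≤ γ·#Plane·‖Y‖_{ℓ¹}`).
§2 along `V_s = e^{sA}`, `s ∈ [0,1]`, `‖A‖ ≤ α₀`, lattice differences `≤ α₁`, `δ = e^{α₀} − 1`: `smallField_flat_zero`, `norm_curlAt_flat_le`
   (`‖d_1A‖ ≤ 2α₁`), `norm_vary_flat_sub_one_le` (`‖V_s(b) − 1‖ ≤ δ`), `norm_hol_vary_flat_sub_one_le` (`‖V_s(∂p) − 1‖ ≤ 2α₁ + 28α₀²`, `μ ≠ ν`),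
   `norm_curlAt_vary_flat_le` (`‖d_sA‖ ≤ 2α₁ + 24δα₀`), **`norm_curlAt_vary_flat_taylor_le`** (`‖d_sA − d_1A − s·𝒬(A)‖ ≤ 960δα₀²`: the mean value
   inequality on `t ↦ d_tA − t𝒬(A)` with `hasDerivAt_curlAt_vary_at` and F47), `dcurlAt_flat_self_periodic`.
HONEST FRAMING (page 1): lattice calculus at the TRIVIAL flat datum; nothing of Bałaban's asserted; NOT (EXP) itself (F48b), NOT (APE), NOT ONE-STEP,
NOT NE7; spine 0∕9; finite T⁴ rung (B)+1 — NOT infinite volume, NOT mass gap, NOT Clay.  Continuum YM on T⁴ ⇐ BetaPertH ∧ nine spine estimates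
(0/9 proved); BetaPertH ⇐ (D1) ∧ (D4) ∧ CAP+tail; G-an2-4 gates asym, D1 and NE2/3/4.
-/

set_option autoImplicit false

open scoped BigOperators Matrix.Norms.L2Operator
open NormedSpace Finset Set

namespace Summit.QuantumFields.BalabanUV.T4Continuum.NE7ExpansionSegmentLetters

open Literature.MathematicalPhysics.QuantumFieldTheory.Balaban1983to89
open B7Prop1Explicit B7Prop2Explicit MatrixLog UnitaryModel
open T4AveragingDeficitWall (IsUnitaryCfg IsSkewDir SmallField vary curlAt dirL1 vary_zero)
open T4AveragingDeficitWallBoundary (periodBox sum_periodBox_shift)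
open AveragingDeficitPeriodicCounting (IsPeriodicDir)
open AveragingDeficitPlaqDeriv (vary_isUnitaryCfg)
open AveragingDeficitNearIdentity (abs_nReTr_mul_le)
open AveragingDeficitDualResidual (pair_le_sum)
open MinimalActionLevels (perWin)
open NE3HessForm (dcurlAt)
open NE3HessBounds (bondSqAt)
open NE3HessContinuity (bondL1At bondL1At_nonneg)
open NE3CurlStability (norm_curlAt_vary_sub_le norm_vary_sub_le_of_sup)
open NE3SmoothLiftCurl (curlAt_flat_eq)
open NE3TangentFlatPush (flatCfg_eq_flat)
open NE7SegmentPlaquetteRadius (norm_hol_taylor_le bondSqAt_le_of_sup hasDerivAt_curlAt_vary_at)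
open BlockAveragePushDirSplit (flat)
open NE7CubicVertexLetters (isUnitaryCfg_flat dcurlAt_flat_shift bondL1At_le_of_sup)
open NE7DcurlBaseLipschitz (norm_dcurlAt_sub_dcurlAt_le)

noncomputable section

variable {d : ℕ} {n : Type*} [Fintype n] [DecidableEq n]

/-! ## §1 Period-box bookkeeping: the window sum of the bond sums, and the by-parts letter at the flat background -/

/-- `Σ_{p ∈ perWin d P} bl₁(Y)(p) ≤ 2·#Plane·‖Y‖_{ℓ¹(periodBox P)}` for a `P`-periodic `Y` (`P ≥ 1`): each of the four bonds of `∂p`, summed over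
the period box, is a full `ℓ¹` sum by shift invariance. [folklore] -/
theorem sum_perWin_bondL1At_le {P : ℕ} (hP : 1 ≤ P) {Y : Site d → Fin d → Matrix n n ℂ} (hYP : IsPeriodicDir Y (P : ℤ)) :
    ∑ p ∈ perWin d P, bondL1At Y p.1 p.2.1.1 p.2.1.2
      ≤ 2 * (Fintype.card (T4AveragingDeficitWall.Plane d) : ℝ) * dirL1 Y (periodBox (d := d) P) := by
  unfold perWin T4AveragingDeficitWall.dirL1
  rw [Finset.sum_product, Finset.sum_comm]
  have hf0 : ∀ i, 0 ≤ ∑ z ∈ periodBox (d := d) P, ‖Y z i‖ := fun i => Finset.sum_nonneg fun _ _ => norm_nonneg _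
  have hshift : ∀ (i j : Fin d), ∑ z ∈ periodBox (d := d) P, ‖Y (z + e i) j‖ = ∑ z ∈ periodBox (d := d) P, ‖Y z j‖ := fun i j =>
    sum_periodBox_shift P hP (g := fun z => ‖Y z j‖) (fun x κ => by rw [hYP x κ j]) (e i)
  calc ∑ π : T4AveragingDeficitWall.Plane d, ∑ z ∈ periodBox (d := d) P, bondL1At Y z π.1.1 π.1.2
      = ∑ π : T4AveragingDeficitWall.Plane d, (2 * ∑ z ∈ periodBox (d := d) P, ‖Y z π.1.1‖ + 2 * ∑ z ∈ periodBox (d := d) P, ‖Y z π.1.2‖) := by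
        refine Finset.sum_congr rfl fun π _ => ?_
        unfold bondL1At
        simp only [Finset.sum_add_distrib, hshift]
        ring
    _ ≤ ∑ _π : T4AveragingDeficitWall.Plane d, 2 * ∑ i, ∑ z ∈ periodBox (d := d) P, ‖Y z i‖ :=
        Finset.sum_le_sum fun π _ => by
          have hp := pair_le_sum (f := fun i => ∑ z ∈ periodBox (d := d) P, ‖Y z i‖) hf0 π
          linarith
    _ = 2 * (Fintype.card (T4AveragingDeficitWall.Plane d) : ℝ) * ∑ z ∈ periodBox (d := d) P, ∑ κ, ‖Y z κ‖ := by
        rw [Finset.sum_const, Finset.card_univ, nsmul_eq_mul, Finset.sum_comm]; ring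

/-- **THE BY-PARTS LETTER AT THE FLAT BACKGROUND.**  For `P ≥ 1`, a `P`-periodic direction field `Y` and a `P`-periodic plaquette field
`G` whose ADJACENT DIFFERENCES are bounded, `‖G(z; μ,ν) − G(z − e_τ; μ,ν)‖ ≤ γ`:
`|Σ_{p ∈ perWin d P} Re tr[(d_1 Y)(p)·G(p)]∕N| ≤ γ·#Plane·‖Y‖_{ℓ¹(periodBox P)}` — the flat curl `(d_1Y)(z;μ,ν) = (Y(z+e_μ,ν) − Y(z,ν)) − (Y(z+e_ν,μ) − Y(z,μ))`
is moved onto `G` by the shift invariance of periodic sums, producing lattice differences of `G` against bare values of `Y`. [folklore] -/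
theorem abs_sum_nReTr_curlAt_flat_mul_le {P : ℕ} (hP : 1 ≤ P) {Y : Site d → Fin d → Matrix n n ℂ} (hYP : IsPeriodicDir Y (P : ℤ))
    {G : Site d → Fin d → Fin d → Matrix n n ℂ} (hGP : ∀ (z : Site d) (κ μ ν : Fin d), G (z + (P : ℤ) • e κ) μ ν = G z μ ν) {γ : ℝ}
    (hG : ∀ (z : Site d) (μ ν τ : Fin d), ‖G z μ ν - G (z - e τ) μ ν‖ ≤ γ) :
    |∑ p ∈ perWin d P, nReTr (curlAt (flat (d := d) (n := n)) Y p.1 p.2.1.1 p.2.1.2 * G p.1 p.2.1.1 p.2.1.2)|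
      ≤ γ * (Fintype.card (T4AveragingDeficitWall.Plane d) : ℝ) * dirL1 Y (periodBox (d := d) P) := by
  unfold perWin T4AveragingDeficitWall.dirL1
  rw [Finset.sum_product, Finset.sum_comm]
  have hf0 : ∀ i, 0 ≤ ∑ z ∈ periodBox (d := d) P, ‖Y z i‖ := fun i => Finset.sum_nonneg fun _ _ => norm_nonneg _
  -- one plane
  have hplane : ∀ π : T4AveragingDeficitWall.Plane d,
      |∑ z ∈ periodBox (d := d) P, nReTr (curlAt (flat (d := d) (n := n)) Y z π.1.1 π.1.2 * G z π.1.1 π.1.2)|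
        ≤ γ * (∑ z ∈ periodBox (d := d) P, ‖Y z π.1.1‖ + ∑ z ∈ periodBox (d := d) P, ‖Y z π.1.2‖) := by
    intro π
    set μ := π.1.1
    set ν := π.1.2
    -- expand the flat curl and split the trace
    have hsplit : ∀ z : Site d, nReTr (curlAt (flat (d := d) (n := n)) Y z μ ν * G z μ ν)
        = (nReTr (Y (z + e μ) ν * G z μ ν) - nReTr (Y z ν * G z μ ν)) - (nReTr (Y (z + e ν) μ * G z μ ν) - nReTr (Y z μ * G z μ ν)) := by
      intro z
      rw [curlAt_flat_eq, sub_mul, sub_mul, sub_mul, T4TiltOscillation.nReTr_sub, T4TiltOscillation.nReTr_sub,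
        T4TiltOscillation.nReTr_sub]
    simp only [hsplit, Finset.sum_sub_distrib]
    -- shift the two forward terms back onto `G`
    have hs1 : ∑ z ∈ periodBox (d := d) P, nReTr (Y (z + e μ) ν * G z μ ν) = ∑ z ∈ periodBox (d := d) P, nReTr (Y z ν * G (z - e μ) μ ν) := by
      have h := sum_periodBox_shift P hP (g := fun z => nReTr (Y z ν * G (z - e μ) μ ν)) (fun x κ => by
        show nReTr (Y (x + (P : ℤ) • e κ) ν * G (x + (P : ℤ) • e κ - e μ) μ ν) = nReTr (Y x ν * G (x - e μ) μ ν)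
        rw [hYP x κ ν, add_sub_right_comm, hGP]) (e μ)
      simp only [add_sub_cancel_right] at h
      exact h
    have hs2 : ∑ z ∈ periodBox (d := d) P, nReTr (Y (z + e ν) μ * G z μ ν) = ∑ z ∈ periodBox (d := d) P, nReTr (Y z μ * G (z - e ν) μ ν) := by
      have h := sum_periodBox_shift P hP (g := fun z => nReTr (Y z μ * G (z - e ν) μ ν)) (fun x κ => by
        show nReTr (Y (x + (P : ℤ) • e κ) μ * G (x + (P : ℤ) • e κ - e ν) μ ν) = nReTr (Y x μ * G (x - e ν) μ ν)
        rw [hYP x κ μ, add_sub_right_comm, hGP]) (e ν)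
      simp only [add_sub_cancel_right] at h
      exact h
    rw [hs1, hs2, ← Finset.sum_sub_distrib, ← Finset.sum_sub_distrib, ← Finset.sum_sub_distrib]
    -- each summand is `Re tr[Y·(ΔG)]`
    have hterm : ∀ z : Site d,
        (nReTr (Y z ν * G (z - e μ) μ ν) - nReTr (Y z ν * G z μ ν)) - (nReTr (Y z μ * G (z - e ν) μ ν) - nReTr (Y z μ * G z μ ν))
          = nReTr (Y z ν * (G (z - e μ) μ ν - G z μ ν)) - nReTr (Y z μ * (G (z - e ν) μ ν - G z μ ν)) := by
      intro z
      rw [mul_sub, mul_sub, T4TiltOscillation.nReTr_sub, T4TiltOscillation.nReTr_sub]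
    simp only [hterm]
    refine (Finset.abs_sum_le_sum_abs _ _).trans ?_
    have hbd : ∀ z ∈ periodBox (d := d) P,
        |nReTr (Y z ν * (G (z - e μ) μ ν - G z μ ν)) - nReTr (Y z μ * (G (z - e ν) μ ν - G z μ ν))| ≤ γ * ‖Y z μ‖ + γ * ‖Y z ν‖ := by
      intro z _
      have h1 := abs_nReTr_mul_le (Y z ν) (G (z - e μ) μ ν - G z μ ν)
      have h2 := abs_nReTr_mul_le (Y z μ) (G (z - e ν) μ ν - G z μ ν)
      have g1 : ‖G (z - e μ) μ ν - G z μ ν‖ ≤ γ := by rw [norm_sub_rev]; exact hG z μ ν μ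
      have g2 : ‖G (z - e ν) μ ν - G z μ ν‖ ≤ γ := by rw [norm_sub_rev]; exact hG z μ ν ν
      have e1 : ‖Y z ν‖ * ‖G (z - e μ) μ ν - G z μ ν‖ ≤ ‖Y z ν‖ * γ := mul_le_mul_of_nonneg_left g1 (norm_nonneg _)
      have e2 : ‖Y z μ‖ * ‖G (z - e ν) μ ν - G z μ ν‖ ≤ ‖Y z μ‖ * γ := mul_le_mul_of_nonneg_left g2 (norm_nonneg _)
      have := abs_sub (nReTr (Y z ν * (G (z - e μ) μ ν - G z μ ν))) (nReTr (Y z μ * (G (z - e ν) μ ν - G z μ ν)))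
      linarith
    refine (Finset.sum_le_sum hbd).trans (le_of_eq ?_)
    rw [Finset.sum_add_distrib, ← Finset.mul_sum, ← Finset.mul_sum]
    ring
  -- sum over planes
  refine (Finset.abs_sum_le_sum_abs _ _).trans ?_
  calc ∑ π : T4AveragingDeficitWall.Plane d, |∑ z ∈ periodBox (d := d) P, nReTr (curlAt (flat (d := d) (n := n)) Y z π.1.1 π.1.2 * G z π.1.1 π.1.2)|
      ≤ ∑ π : T4AveragingDeficitWall.Plane d, γ * (∑ z ∈ periodBox (d := d) P, ‖Y z π.1.1‖ + ∑ z ∈ periodBox (d := d) P, ‖Y z π.1.2‖) :=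
        Finset.sum_le_sum fun π _ => hplane π
    _ ≤ ∑ _π : T4AveragingDeficitWall.Plane d, γ * ∑ i, ∑ z ∈ periodBox (d := d) P, ‖Y z i‖ :=
        Finset.sum_le_sum fun π _ => by
          have hγ : 0 ≤ γ := (norm_nonneg _).trans (hG 0 π.1.1 π.1.2 π.1.1)
          exact mul_le_mul_of_nonneg_left (pair_le_sum (f := fun i => ∑ z ∈ periodBox (d := d) P, ‖Y z i‖) hf0 π) hγ
    _ = γ * (Fintype.card (T4AveragingDeficitWall.Plane d) : ℝ) * ∑ z ∈ periodBox (d := d) P, ∑ κ, ‖Y z κ‖ := by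
        rw [Finset.sum_const, Finset.card_univ, nsmul_eq_mul, Finset.sum_comm]; ring

/-! ## §2 Letters along the segment `V_s = e^{sA}` at the trivial flat datum -/

/-- The flat background has plaquette radius `0`. [folklore] -/
theorem smallField_flat_zero : SmallField (flat (d := d) (n := n)) 0 := by
  rw [← flatCfg_eq_flat]; exact NE3FlatHessianCurl.smallField_flatCfg_zero

/-- **`‖(d_1 A)(p)‖ ≤ 2α₁`**: the flat curl is a sum of two lattice differences of `A`. [folklore] -/
theorem norm_curlAt_flat_le {A : Site d → Fin d → Matrix n n ℂ} {α₁ : ℝ}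
    (hA1 : ∀ (y : Site d) (κ τ : Fin d), ‖A (y + e τ) κ - A y κ‖ ≤ α₁) (z : Site d) (μ ν : Fin d) :
    ‖curlAt (flat (d := d) (n := n)) A z μ ν‖ ≤ 2 * α₁ := by
  rw [curlAt_flat_eq]
  have h1 := hA1 z ν μ
  have h2 := hA1 z μ ν
  calc ‖(A (z + e μ) ν - A z ν) - (A (z + e ν) μ - A z μ)‖ ≤ ‖A (z + e μ) ν - A z ν‖ + ‖A (z + e ν) μ - A z μ‖ := norm_sub_le _ _
    _ ≤ α₁ + α₁ := add_le_add h1 h2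
    _ = 2 * α₁ := by ring

/-- `‖V_s(b) − 1‖ ≤ e^{α₀} − 1` for `s ∈ [0,1]`, `‖A‖ ≤ α₀` (row NE3's `norm_vary_sub_le_of_sup` at the flat background). [folklore] -/
theorem norm_vary_flat_sub_one_le [Nonempty n] {A : Site d → Fin d → Matrix n n ℂ} {α₀ : ℝ} (hAα : ∀ y κ, ‖A y κ‖ ≤ α₀)
    {s : ℝ} (hs : s ∈ Icc (0 : ℝ) 1) (x : Site d) (κ : Fin d) :
    ‖((vary (flat (d := d) (n := n)) A s x κ : (Matrix n n ℂ)ˣ) : Matrix n n ℂ) - ((flat (d := d) (n := n) x κ : (Matrix n n ℂ)ˣ) : Matrix n n ℂ)‖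
      ≤ Real.exp α₀ - 1 := by
  have hα : 0 ≤ α₀ := (norm_nonneg _).trans (hAα x κ)
  have h := norm_vary_sub_le_of_sup (isUnitaryCfg_flat (d := d) (n := n)) hAα s x κ
  refine h.trans ?_
  have hs1 : |s| ≤ 1 := abs_le.mpr ⟨by linarith [hs.1], hs.2⟩
  have : |s| * α₀ ≤ α₀ := by nlinarith
  linarith [Real.exp_le_exp.mpr this]

/-- **`‖V_s(∂p) − 1‖ ≤ 2α₁ + 28α₀²`** for `s ∈ [0,1]`, `μ ≠ ν`: the Taylor bound `norm_hol_taylor_le` between `0` and `s` at the flat background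
(`V_0(∂p) = 1`, velocity `s·(d_1A)(p)` of size `≤ 2α₁`, remainder `7·bondSqAt·s² ≤ 28α₀²`). [folklore] -/
theorem norm_hol_vary_flat_sub_one_le [Nonempty n] {A : Site d → Fin d → Matrix n n ℂ} (hA : IsSkewDir A) {α₀ α₁ : ℝ}
    (hAα : ∀ y κ, ‖A y κ‖ ≤ α₀) (hA1 : ∀ (y : Site d) (κ τ : Fin d), ‖A (y + e τ) κ - A y κ‖ ≤ α₁)
    {s : ℝ} (hs : s ∈ Icc (0 : ℝ) 1) (z : Site d) {μ ν : Fin d} (hμν : μ ≠ ν) :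
    ‖((hol (vary (flat (d := d) (n := n)) A s) z (plaqWord μ ν) : (Matrix n n ℂ)ˣ) : Matrix n n ℂ) - 1‖ ≤ 2 * α₁ + 28 * α₀ ^ 2 := by
  have h1 : ((hol (flat (d := d) (n := n)) z (plaqWord μ ν) : (Matrix n n ℂ)ˣ) : Matrix n n ℂ) = 1 := by
    have h := smallField_flat_zero (d := d) (n := n) z μ ν hμν
    have : ‖((hol (flat (d := d) (n := n)) z (plaqWord μ ν) : (Matrix n n ℂ)ˣ) : Matrix n n ℂ) - 1‖ = 0 := le_antisymm h (norm_nonneg _)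
    exact sub_eq_zero.mp (norm_eq_zero.mp this)
  have hT := norm_hol_taylor_le (isUnitaryCfg_flat (d := d) (n := n)) hA z μ ν 0 s
  rw [vary_zero, h1, sub_zero, mul_one] at hT
  have hb := bondSqAt_le_of_sup hAα z μ ν
  have hs2 : s ^ 2 ≤ 1 := by nlinarith [hs.1, hs.2]
  have hbs : 7 * bondSqAt A z μ ν * s ^ 2 ≤ 28 * α₀ ^ 2 := by
    have hB0 : 0 ≤ bondSqAt A z μ ν := by unfold bondSqAt; positivity
    nlinarith
  have hv : ‖s • curlAt (flat (d := d) (n := n)) A z μ ν‖ ≤ 2 * α₁ := by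
    rw [norm_smul, Real.norm_eq_abs, abs_of_nonneg hs.1]
    have hc := norm_curlAt_flat_le (n := n) hA1 z μ ν
    calc s * ‖curlAt (flat (d := d) (n := n)) A z μ ν‖ ≤ 1 * ‖curlAt (flat (d := d) (n := n)) A z μ ν‖ :=
          mul_le_mul_of_nonneg_right hs.2 (norm_nonneg _)
      _ ≤ 2 * α₁ := by rw [one_mul]; exact hc
  have htri : ‖((hol (vary (flat (d := d) (n := n)) A s) z (plaqWord μ ν) : (Matrix n n ℂ)ˣ) : Matrix n n ℂ) - 1‖
      ≤ ‖((hol (vary (flat (d := d) (n := n)) A s) z (plaqWord μ ν) : (Matrix n n ℂ)ˣ) : Matrix n n ℂ) - 1 - s • curlAt (flat (d := d) (n := n)) A z μ ν‖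
        + ‖s • curlAt (flat (d := d) (n := n)) A z μ ν‖ := by
    have := norm_add_le (((hol (vary (flat (d := d) (n := n)) A s) z (plaqWord μ ν) : (Matrix n n ℂ)ˣ) : Matrix n n ℂ) - 1
      - s • curlAt (flat (d := d) (n := n)) A z μ ν) (s • curlAt (flat (d := d) (n := n)) A z μ ν)
    simpa using this
  linarith

/-- **`‖(d_{V_s}A)(p)‖ ≤ 2α₁ + 24(e^{α₀} − 1)α₀`** for `s ∈ [0,1]` (`norm_curlAt_vary_sub_le` + §2's flat curl bound). [folklore] -/
theorem norm_curlAt_vary_flat_le [Nonempty n] {A : Site d → Fin d → Matrix n n ℂ} (hA : IsSkewDir A) {α₀ α₁ : ℝ}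
    (hAα : ∀ y κ, ‖A y κ‖ ≤ α₀) (hA1 : ∀ (y : Site d) (κ τ : Fin d), ‖A (y + e τ) κ - A y κ‖ ≤ α₁)
    {s : ℝ} (hs : s ∈ Icc (0 : ℝ) 1) (z : Site d) (μ ν : Fin d) :
    ‖curlAt (vary (flat (d := d) (n := n)) A s) A z μ ν‖ ≤ 2 * α₁ + 24 * (Real.exp α₀ - 1) * α₀ := by
  have hα : 0 ≤ α₀ := (norm_nonneg _).trans (hAα z μ)
  have h := norm_curlAt_vary_sub_le (isUnitaryCfg_flat (d := d) (n := n)) hA hAα s A z μ ν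
  have hb : bondL1At A z μ ν ≤ 4 * α₀ := bondL1At_le_of_sup hAα z μ ν
  have hb0 : 0 ≤ bondL1At A z μ ν := bondL1At_nonneg A z μ ν
  have hs1 : |s| ≤ 1 := abs_le.mpr ⟨by linarith [hs.1], hs.2⟩
  have hexp : Real.exp (|s| * α₀) - 1 ≤ Real.exp α₀ - 1 := by
    have : |s| * α₀ ≤ α₀ := by nlinarith
    linarith [Real.exp_le_exp.mpr this]
  have hδ0 : 0 ≤ Real.exp (|s| * α₀) - 1 := by
    have : 0 ≤ |s| * α₀ := mul_nonneg (abs_nonneg s) hα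
    linarith [Real.one_le_exp this]
  have h0 := norm_curlAt_flat_le (n := n) hA1 z μ ν
  have htri : ‖curlAt (vary (flat (d := d) (n := n)) A s) A z μ ν‖
      ≤ ‖curlAt (vary (flat (d := d) (n := n)) A s) A z μ ν - curlAt (flat (d := d) (n := n)) A z μ ν‖ + ‖curlAt (flat (d := d) (n := n)) A z μ ν‖ := by
    have := norm_add_le (curlAt (vary (flat (d := d) (n := n)) A s) A z μ ν - curlAt (flat (d := d) (n := n)) A z μ ν) (curlAt (flat (d := d) (n := n)) A z μ ν)
    simpa using this
  have hmid : 6 * (Real.exp (|s| * α₀) - 1) * bondL1At A z μ ν ≤ 24 * (Real.exp α₀ - 1) * α₀ := by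
    calc 6 * (Real.exp (|s| * α₀) - 1) * bondL1At A z μ ν ≤ 6 * (Real.exp α₀ - 1) * (4 * α₀) :=
          mul_le_mul (mul_le_mul_of_nonneg_left hexp (by norm_num)) hb hb0 (by linarith)
      _ = 24 * (Real.exp α₀ - 1) * α₀ := by ring
  linarith

/-- **THE TAYLOR TAIL OF THE CURL ALONG THE SEGMENT**: `‖(d_{V_s}A)(p) − (d_1A)(p) − s·𝒬(A)(p)‖ ≤ 960(e^{α₀} − 1)α₀²` for `s ∈ [0,1]`,
`𝒬(A) = dcurlAt 1 A A` — mean value on `t ↦ (d_{V_t}A)(p) − t·𝒬(A)(p)` whose derivative `dcurlAt V_t A A − dcurlAt 1 A A`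
(`hasDerivAt_curlAt_vary_at`) is `≤ 60(e^{α₀}−1)·bl₁(A)²` by F47 (`‖V_t(b) − 1‖ ≤ e^{α₀} − 1`). [folklore] -/
theorem norm_curlAt_vary_flat_taylor_le [Nonempty n] {A : Site d → Fin d → Matrix n n ℂ} (hA : IsSkewDir A) {α₀ : ℝ}
    (hAα : ∀ y κ, ‖A y κ‖ ≤ α₀) {s : ℝ} (hs : s ∈ Icc (0 : ℝ) 1) (z : Site d) (μ ν : Fin d) :
    ‖curlAt (vary (flat (d := d) (n := n)) A s) A z μ ν - curlAt (flat (d := d) (n := n)) A z μ ν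
        - s • dcurlAt (flat (d := d) (n := n)) A A z μ ν‖ ≤ 960 * (Real.exp α₀ - 1) * α₀ ^ 2 := by
  have hα : 0 ≤ α₀ := (norm_nonneg _).trans (hAα z μ)
  set Q : Matrix n n ℂ := dcurlAt (flat (d := d) (n := n)) A A z μ ν with hQ
  set f : ℝ → Matrix n n ℂ := fun t => curlAt (vary (flat (d := d) (n := n)) A t) A z μ ν - t • Q with hf
  have hfd : ∀ t : ℝ, HasDerivAt f (dcurlAt (vary (flat (d := d) (n := n)) A t) A A z μ ν - Q) t := by
    intro t
    have h1 := hasDerivAt_curlAt_vary_at (flat (d := d) (n := n)) A A z μ ν t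
    have h2 : HasDerivAt (fun t : ℝ => t • Q) ((1 : ℝ) • Q) t := (hasDerivAt_id t).smul_const Q
    rw [one_smul] at h2
    exact h1.sub h2
  have hδ : 0 ≤ Real.exp α₀ - 1 := by linarith [Real.one_le_exp hα]
  have hbd : ∀ t ∈ Ico (0 : ℝ) 1, ‖dcurlAt (vary (flat (d := d) (n := n)) A t) A A z μ ν - Q‖ ≤ 960 * (Real.exp α₀ - 1) * α₀ ^ 2 := by
    intro t ht
    have ht' : t ∈ Icc (0 : ℝ) 1 := ⟨ht.1, ht.2.le⟩
    have hl := fun x κ => norm_vary_flat_sub_one_le (d := d) (n := n) hAα ht' x κ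
    have h := norm_dcurlAt_sub_dcurlAt_le (isUnitaryCfg_flat (d := d) (n := n))
      (vary_isUnitaryCfg (isUnitaryCfg_flat (d := d) (n := n)) hA t) A A z μ ν (hl z μ) (hl (z + e μ) ν) (hl (z + e ν) μ)
    have hb : bondL1At A z μ ν ≤ 4 * α₀ := bondL1At_le_of_sup hAα z μ ν
    have hb0 : 0 ≤ bondL1At A z μ ν := bondL1At_nonneg A z μ ν
    have hsq : bondL1At A z μ ν * bondL1At A z μ ν ≤ (4 * α₀) * (4 * α₀) := mul_le_mul hb hb hb0 (by positivity)
    rw [hQ]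
    calc ‖dcurlAt (vary (flat (d := d) (n := n)) A t) A A z μ ν - dcurlAt (flat (d := d) (n := n)) A A z μ ν‖
        ≤ 60 * (Real.exp α₀ - 1) * (bondL1At A z μ ν * bondL1At A z μ ν) := h
      _ ≤ 60 * (Real.exp α₀ - 1) * ((4 * α₀) * (4 * α₀)) := mul_le_mul_of_nonneg_left hsq (by positivity)
      _ = 960 * (Real.exp α₀ - 1) * α₀ ^ 2 := by ring
  have hmv := norm_image_sub_le_of_norm_deriv_le_segment' (f := f) (a := 0) (b := 1)
    (fun t _ => (hfd t).hasDerivWithinAt) hbd s hs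
  have hf0 : f 0 = curlAt (flat (d := d) (n := n)) A z μ ν := by simp [hf, vary_zero]
  have hfs : f s - f 0 = curlAt (vary (flat (d := d) (n := n)) A s) A z μ ν - curlAt (flat (d := d) (n := n)) A z μ ν - s • Q := by
    rw [hf0]; simp only [hf]; abel
  rw [← hfs]
  refine hmv.trans ?_
  have : 960 * (Real.exp α₀ - 1) * α₀ ^ 2 * (s - 0) ≤ 960 * (Real.exp α₀ - 1) * α₀ ^ 2 * 1 :=
    mul_le_mul_of_nonneg_left (by linarith [hs.2]) (by positivity)
  linarith

/-- `𝒬(A) = dcurlAt 1 A A` is `P`-periodic in the corner for a `P`-periodic `A` (translation covariance, F46 `dcurlAt_flat_shift`). [folklore] -/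
theorem dcurlAt_flat_self_periodic {P : ℤ} {A : Site d → Fin d → Matrix n n ℂ} (hAP : IsPeriodicDir A P)
    (z : Site d) (κ μ ν : Fin d) :
    dcurlAt (flat (d := d) (n := n)) A A (z + P • e κ) μ ν = dcurlAt (flat (d := d) (n := n)) A A z μ ν := by
  have hshift : (fun (y : Site d) (κ' : Fin d) => A (y - (-(P • e κ))) κ') = A := by
    funext y κ'
    simp only [sub_neg_eq_add]
    exact hAP y κ κ'
  have h := dcurlAt_flat_shift (n := n) A A (-(P • e κ)) z μ ν
  rw [hshift, sub_neg_eq_add] at h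
  exact h.symm

end

end Summit.QuantumFields.BalabanUV.T4Continuum.NE7ExpansionSegmentLetters
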